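import Summits.QuantumFields.YangMills.Theorems.ColdStartUniversalityLatticeLangevinExpMixing
import HarnessLib

/-!
# Route `ColdStartUniversality` (crux K_A1 stmt-QuantumFields-24809; fixed-cut-off package):
# THE WILSON MEASURE IS THE UNIQUE INVARIANT LAW of the SU(2) lattice Langevin dynamics, and EVERY initial law converges to it

Helper file (seat `ym-line-csu-p1`, g10; `--supports stmt-QuantumFields-24809`).  Completes the fixed-cut-off ergodic package of
the SZZ dynamics for `SU(2)`, `d = 3` (well-posedness `latticeLangevinWellPosed_su2`, invariance `wilsonMeasureLangevinInvariant_su2`,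
Doeblin `doeblin_szz`, exponential mixing `exp_mixing_szz`) by the two statements a reader of SZZ §3 expects next:

* `exp_mixing_kernel` — the mixing bound on THE transition kernels: `|∫ f d(κ_t z) − ∫ f dμ_W| ≤ C e^{−ct}` for every start `z`,
  time `t`, measurable `|f| ≤ 1` (any Markov kernel family realising the transition laws);
* `integral_bind_sub_le` — EVERY initial law `ν` converges: `|∫ f d(ν κ_t) − ∫ f dμ_W| ≤ C e^{−ct}`;
* `eq_wilsonMeasure_of_invariant` — ★ UNIQUENESS: a probability measure invariant under the kernels at all times IS the Wilson measure
  (hence, with `wilsonMeasureLangevinInvariant_su2`, the Wilson–Gibbs law is the unique stationary law of the dynamics at every coupling).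

THEOREMS ONLY, no sorry, standard axioms.  HONEST FRAMING: fixed cut-off (constants depend on `L, β'`); nothing uniform in the
cut-off; no crux, rung R3 or summit is proved; the Yang–Mills mass gap is NOT proved.
-/

set_option autoImplicit false

noncomputable section

namespace Summit.QuantumFields.YangMills.Theorems.ColdStartUniversality

open MeasureTheory ProbabilityTheory
open scoped NNReal ENNReal
open Literature.Probability.Process Literature.MathematicalPhysics.QuantumFieldTheory
open Literature.MathematicalPhysics.QuantumLattice (fundamentalRep fundamentalLatticeRep continuous_fundamentalRep)

variable {L : ℕ} [NeZero L]

/-- **Exponential mixing of THE transition kernels** of the SU(2) SZZ dynamics: for any Markov kernel family realising the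
transition laws, `|∫ f d(κ_t z) − ∫ f dμ_W| ≤ C e^{−ct}` uniformly in the start (the kernels are laws of the regular flow on the
product Wiener space, `exists_regularFlow`; then `exp_mixing_szz_map`). [cite: HairerMattingly2011, Theorems 1.2 and 1.3] -/
theorem exp_mixing_kernel (β' : ℝ)
    (κ : ℝ≥0 → Kernel (GaugeConfig 3 L (Matrix.specialUnitaryGroup (Fin 2) ℂ))
      (GaugeConfig 3 L (Matrix.specialUnitaryGroup (Fin 2) ℂ)))
    (hreal : ∀ (t : ℝ≥0) (x : GaugeConfig 3 L (Matrix.specialUnitaryGroup (Fin 2) ℂ))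
        (Ω : Type) [MeasurableSpace Ω] (P : Measure Ω) [IsProbabilityMeasure P]
        (W : ℝ≥0 → Ω → (Edge 3 L × NoiseIdx 2 → ℝ)) (hW : IsFlatBrownian W P)
        (U : ℝ≥0 → Ω → GaugeConfig 3 L (Matrix.specialUnitaryGroup (Fin 2) ℂ)),
        (∀ ω, U 0 ω = x) →
        (latticeLangevinDynamics (fundamentalLatticeRep 2) β').IsSolution (fundamentalRep (Fin 2))
          hW.natFiltration P W U →
        κ t x = P.map (U t)) :
    ∃ C c : ℝ, 0 < C ∧ 0 < c ∧
      ∀ (z : GaugeConfig 3 L (Matrix.specialUnitaryGroup (Fin 2) ℂ)) (t : ℝ≥0)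
        (f : GaugeConfig 3 L (Matrix.specialUnitaryGroup (Fin 2) ℂ) → ℝ), Measurable f → (∀ y, |f y| ≤ 1) →
        |(∫ y, f y ∂(κ t z)) - ∫ y, f y ∂(wilsonMeasure (d := 3) (L := L) (fundamentalRep (Fin 2)) β')| ≤
          C * Real.exp (-c * t) := by
  classical
  haveI := isProbabilityMeasure_piWiener (Edge 3 L × NoiseIdx 2)
  have hWc := isFlatBrownian_piWiener 3 L (NoiseIdx 2)
  obtain ⟨X, -, hX, -, -, -, -⟩ := exists_regularFlow L β' hWc
  obtain ⟨C, c, hC, hc, h⟩ := exp_mixing_szz_map L β'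
  refine ⟨C, c, hC, hc, fun z t f hf hf1 => ?_⟩
  rw [hreal t z _ _ _ hWc (X z) (hX z).1 (hX z).2]
  exact h z t f hf hf1 _ _ _ hWc (X z) (hX z).1 (hX z).2

/-- **Every initial law converges to the Wilson measure**: for a probability measure `ν` of starts,
`|∫ f d(ν.bind κ_t) − ∫ f dμ_W| ≤ C e^{−ct}` for all measurable `|f| ≤ 1`, with the constants of `exp_mixing_kernel`. [folklore] -/
theorem integral_bind_sub_le (β' : ℝ)
    (κ : ℝ≥0 → Kernel (GaugeConfig 3 L (Matrix.specialUnitaryGroup (Fin 2) ℂ))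
      (GaugeConfig 3 L (Matrix.specialUnitaryGroup (Fin 2) ℂ))) [∀ t, IsMarkovKernel (κ t)]
    {C c : ℝ}
    (hmix : ∀ (z : GaugeConfig 3 L (Matrix.specialUnitaryGroup (Fin 2) ℂ)) (t : ℝ≥0)
        (f : GaugeConfig 3 L (Matrix.specialUnitaryGroup (Fin 2) ℂ) → ℝ), Measurable f → (∀ y, |f y| ≤ 1) →
        |(∫ y, f y ∂(κ t z)) - ∫ y, f y ∂(wilsonMeasure (d := 3) (L := L) (fundamentalRep (Fin 2)) β')| ≤
          C * Real.exp (-c * t))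
    (ν : Measure (GaugeConfig 3 L (Matrix.specialUnitaryGroup (Fin 2) ℂ))) [IsProbabilityMeasure ν] (t : ℝ≥0)
    (f : GaugeConfig 3 L (Matrix.specialUnitaryGroup (Fin 2) ℂ) → ℝ) (hf : Measurable f) (hf1 : ∀ y, |f y| ≤ 1) :
    |(∫ y, f y ∂(ν.bind (κ t))) - ∫ y, f y ∂(wilsonMeasure (d := 3) (L := L) (fundamentalRep (Fin 2)) β')| ≤
      C * Real.exp (-c * t) := by
  haveI : IsProbabilityMeasure (ν.bind (κ t)) := by
    constructor
    rw [Measure.bind_apply MeasurableSet.univ (κ t).measurable.aemeasurable]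
    simp
  have hfi : ∀ μ : Measure (GaugeConfig 3 L (Matrix.specialUnitaryGroup (Fin 2) ℂ)), IsProbabilityMeasure μ →
      Integrable f μ := fun μ _ =>
    (integrable_const (1 : ℝ)).mono' hf.aestronglyMeasurable
      (ae_of_all _ fun y => by rw [Real.norm_eq_abs]; exact hf1 y)
  -- `∫ f d(ν κ_t) = ∫ (κ_t f) dν`
  have hbind : ∫ y, f y ∂(ν.bind (κ t)) = ∫ z, (∫ y, f y ∂(κ t z)) ∂ν :=
    Harris.integral_comp_measure (κ t) ν (hfi _ inferInstance)
  set m : ℝ := ∫ y, f y ∂(wilsonMeasure (d := 3) (L := L) (fundamentalRep (Fin 2)) β') with hm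
  have hgm : Measurable fun z => ∫ y, f y ∂(κ t z) :=
    (hf.stronglyMeasurable.integral_kernel (κ := κ t)).measurable
  have hgb : ∀ z, |∫ y, f y ∂(κ t z)| ≤ 1 := fun z => by
    have h1 : |∫ y, f y ∂(κ t z)| ≤ ∫ y, |f y| ∂(κ t z) := abs_integral_le_integral_abs
    have h2 : ∫ y, |f y| ∂(κ t z) ≤ ∫ _y, (1 : ℝ) ∂(κ t z) :=
      integral_mono (hfi _ inferInstance).abs (integrable_const _) fun y => hf1 y
    rw [integral_const, probReal_univ, one_smul] at h2
    exact h1.trans h2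
  have hgi : Integrable (fun z => ∫ y, f y ∂(κ t z)) ν :=
    (integrable_const (1 : ℝ)).mono' hgm.aestronglyMeasurable
      (ae_of_all _ fun z => by rw [Real.norm_eq_abs]; exact hgb z)
  rw [hbind]
  have hsub : (∫ z, (∫ y, f y ∂(κ t z)) ∂ν) - m = ∫ z, ((∫ y, f y ∂(κ t z)) - m) ∂ν := by
    rw [integral_sub hgi (integrable_const m), integral_const, probReal_univ, one_smul]
  rw [hsub]
  calc |∫ z, ((∫ y, f y ∂(κ t z)) - m) ∂ν| ≤ ∫ z, |(∫ y, f y ∂(κ t z)) - m| ∂ν := abs_integral_le_integral_abs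
    _ ≤ ∫ _z, C * Real.exp (-c * t) ∂ν :=
        integral_mono (hgi.sub (integrable_const m)).abs (integrable_const _) fun z => hmix z t f hf hf1
    _ = C * Real.exp (-c * t) := by rw [integral_const, probReal_univ, one_smul]

/-- ★ **Uniqueness of the invariant law**: a probability measure invariant under THE transition kernels of the SU(2) SZZ
dynamics at every time is the Wilson–Gibbs measure (test an indicator: `μ(A) = (μ κ_t)(A) → μ_W(A)`).  With
`wilsonMeasureLangevinInvariant_su2` the Wilson measure is therefore the UNIQUE stationary law at every coupling.
[cite: ShenZhuZhu2022, §3 Lemma 3.3 (p. 13)] [folklore] -/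
theorem eq_wilsonMeasure_of_invariant (β' : ℝ)
    (κ : ℝ≥0 → Kernel (GaugeConfig 3 L (Matrix.specialUnitaryGroup (Fin 2) ℂ))
      (GaugeConfig 3 L (Matrix.specialUnitaryGroup (Fin 2) ℂ))) [∀ t, IsMarkovKernel (κ t)]
    (hreal : ∀ (t : ℝ≥0) (x : GaugeConfig 3 L (Matrix.specialUnitaryGroup (Fin 2) ℂ))
        (Ω : Type) [MeasurableSpace Ω] (P : Measure Ω) [IsProbabilityMeasure P]
        (W : ℝ≥0 → Ω → (Edge 3 L × NoiseIdx 2 → ℝ)) (hW : IsFlatBrownian W P)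
        (U : ℝ≥0 → Ω → GaugeConfig 3 L (Matrix.specialUnitaryGroup (Fin 2) ℂ)),
        (∀ ω, U 0 ω = x) →
        (latticeLangevinDynamics (fundamentalLatticeRep 2) β').IsSolution (fundamentalRep (Fin 2))
          hW.natFiltration P W U →
        κ t x = P.map (U t))
    (μ : Measure (GaugeConfig 3 L (Matrix.specialUnitaryGroup (Fin 2) ℂ))) [IsProbabilityMeasure μ]
    (hinv : ∀ t, Kernel.Invariant (κ t) μ) :
    μ = wilsonMeasure (d := 3) (L := L) (fundamentalRep (Fin 2)) β' := by
  haveI : IsProbabilityMeasure (wilsonMeasure (d := 3) (L := L) (fundamentalRep (Fin 2)) β') :=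
    isProbabilityMeasure_wilsonMeasure (d := 3) (L := L) (fundamentalRep (Fin 2)) (continuous_fundamentalRep (Fin 2)) β'
  obtain ⟨C, c, hC, hc, hmix⟩ := exp_mixing_kernel (L := L) β' κ hreal
  refine Measure.ext fun A hA => ?_
  -- test the indicator of `A` at every time and let `t → ∞`
  have hfm : Measurable (A.indicator fun _ => (1 : ℝ)) := measurable_const.indicator hA
  have hf1 : ∀ y, |A.indicator (fun _ => (1 : ℝ)) y| ≤ 1 := fun y => by
    by_cases hy : y ∈ A <;> simp [hy]
  have hreal_eq : ∀ t : ℝ≥0, |μ.real A - (wilsonMeasure (d := 3) (L := L) (fundamentalRep (Fin 2)) β').real A| ≤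
      C * Real.exp (-c * t) := by
    intro t
    have h := integral_bind_sub_le (L := L) β' κ hmix μ t _ hfm hf1
    rw [hinv t] at h
    rwa [integral_indicator hA, integral_indicator hA, setIntegral_const, setIntegral_const, smul_eq_mul, smul_eq_mul,
      mul_one, mul_one] at h
  have hzero : |μ.real A - (wilsonMeasure (d := 3) (L := L) (fundamentalRep (Fin 2)) β').real A| ≤ 0 := by
    refine le_of_forall_pos_le_add fun ε hε => ?_
    rw [zero_add]
    -- choose `t` with `C e^{-ct} ≤ ε`
    obtain ⟨t, ht⟩ : ∃ t : ℝ≥0, C * Real.exp (-c * t) ≤ ε := by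
      set T : ℝ := max 0 (Real.log (C / ε) / c) with hT
      have hT0 : 0 ≤ T := le_max_left _ _
      refine ⟨T.toNNReal, ?_⟩
      rw [Real.coe_toNNReal _ hT0]
      have hlog : Real.log (C / ε) ≤ c * T := by
        have h := le_max_right 0 (Real.log (C / ε) / c)
        rw [← hT, div_le_iff₀ hc] at h
        linarith [mul_comm T c]
      have h1 : Real.exp (-c * T) ≤ Real.exp (-Real.log (C / ε)) := Real.exp_le_exp.2 (by linarith)
      rw [Real.exp_neg, Real.exp_log (div_pos hC hε), inv_div] at h1
      calc C * Real.exp (-c * T) ≤ C * (ε / C) := mul_le_mul_of_nonneg_left h1 hC.le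
        _ = ε := mul_div_cancel₀ ε hC.ne'
    exact (hreal_eq t).trans ht
  have hEq : μ.real A = (wilsonMeasure (d := 3) (L := L) (fundamentalRep (Fin 2)) β').real A := by
    have := abs_nonpos_iff.mp hzero
    linarith
  exact (ENNReal.toReal_eq_toReal_iff' (measure_ne_top _ _) (measure_ne_top _ _)).mp hEq

end Summit.QuantumFields.YangMills.Theorems.ColdStartUniversality

end
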